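import Summits.BirchSwinnertonDyer.Rank1Residual.JET.RingClassTransverseLocal
import Literature.NumberTheory.EllipticCurves.KolyvaginPrimeTorsionFixingOfIndex
import Literature.NumberTheory.EllipticCurves.HeegnerPointsKolyvaginPrimaryClassesProofs
import HarnessLib

/-!
# McCallum 1991, Prop. 4.4 under (irr) — KERNEL ROUTE, step (a): `c_M(m)` at a Kolyvagin prime `λ ∤ m` is the
# KUMMER COCYCLE of `P_m` on the decomposition group, so `ord c_M(m)_λ` is the order of `g ↦ g(P_m/p^M) − P_m/p^M`
# on `Γ_{K_λ}` (McCallum Lemma 4.3, second clause, in kernel currency; image-free)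
# (cell `bsd-stepL`, seat `bsd-stepL-corner-p1` g9; `--supports stmt-BirchSwinnertonDyer-19947`; memo CORNER-G9 §3)

WHAT. Sibling of `…KolyJProp44Manin` (step (c)). Here step (a) of CORNER-G9 §3:
* §1 `smul_ringClassField_eq_self_of_mem_decompositionSubgroup` — the decomposition group of any prime `𝔓 ∣ λ = (ℓ)`
  of `\bar ℤ_K` fixes every `K`-embedded copy of the ring class field `K[f]` for `ℓ ∤ f` («`λ` is principal, generated by
  an integer prime to `f`, so splits completely in `K_f`», Gross 1991 proof of Prop. 3.7 (2); McCallum p. 301 «there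
  is an embedding `K_m ↪ K_λ`»): bsd-jet's `JET.smul_ringClassFieldOne_eq_self_of_mem_decompositionSubgroup` VERBATIM
  with conductor `f` for `1` (the splitting lemma `mem_splitPrimes_ringClassField_of_span_natCast` is already general).
* §2 `smul_toGeomPoints_eq_of_mem_decompositionSubgroup` — hence it fixes `E(K[m]) ⊆ E(K̄)` (the datum's embedding),
  in particular the derived point `P_m`; `absGaloisRestrict_smul_toGeomPoints_eq` — the form for `Γ_{K_λ}`
  (`G_{𝔓₀} = res Γ_{K_λ}`, tree `decompositionSubgroup_adicCompletionPrime_eq_range`).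
* §3 `kolyvaginClass_mem_torsionLocalKer_iff_forall_smul_eq` (any number field, any admissible `A`, any `K`-field `E`
  whose Galois group fixes `P` AND `E[n]`): McCallum's class `c(P)` dies in `H¹(E, E[n])` iff `Γ_E` fixes the root
  `Q = P/n` — the cocycle on `Γ_E` is `g ↦ gQ − Q` (McCallum Lemma 4.3 «`c_M(n)_λ = δ(P_n)`»), a coboundary of the
  TRIVIAL module `E[n]` only if zero; `zsmul_kolyvaginClass_mem_torsionLocalKer_iff` — the same for `k • c(P)`
  (`= c(kP)` with root `kQ`), i.e. the ORDER of `c(P)_E` is the order of the homomorphism `g ↦ gQ − Q` on `Γ_E`.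
* §4 `kolyvaginClass_conductor_mem_torsionLocalKer_iff` — assembled for the concrete `c_M(m)` of a Kolyvagin–Heegner
  datum at the place `λ` of a Zhang–Kolyvagin prime `ℓ ∤ m` of index `≥ M` (`Γ_{K_λ}` fixes `E[p^M]`:
  `absGaloisRestrict_smul_geomTorsion_eq_of_le_kolyvaginIndex`; fixes `P_m`: §2).
What remains of Prop. 4.4 after (a) + (c): the reduction picture (b) (`red((g−1)Q) = (F² − 1)x` on a Frobenius,
`red c_M(mℓ)(σ) = ((ℓ+1)F − a_ℓ)x` via Gross Prop. 3.7 (2)) — CORNER-G9 §3.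
HONEST FRAMING: theorems only; no definition ∕ fact ∕ sorry; nothing about BSD; no stub closes; T7.
References: [McCallumLMS1991] §4 Lemma 4.3, Prop. 4.4 (p. 301), (4)–(6); [GrossLMS1991] §3 (proof of Prop. 3.7 (2)), §4,
Prop. 6.2; [Cox2013] Thm. 9.18 ∕ §9 (ring class fields: splitting of principal primes); [NeukirchANT1999] I §9, II (9.6).
-/

set_option autoImplicit false
set_option linter.dupNamespace false

noncomputable section

open scoped Classical NumberField

namespace Summit.BirchSwinnertonDyer.BirchSwinnertonDyer.Theorems.Prop44

open WeierstrassCurve NumberField IsDedekindDomain Field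
  Literature.NumberTheory.EllipticCurves Literature.NumberTheory.GaloisRepresentations
  Literature.NumberTheory.EllipticCurves.KolyvaginCocycle Literature.NumberTheory.EllipticCurves.ModularForms
  Literature.NumberTheory.Automorphic

/-! ### §1 The decomposition group at `λ = (ℓ)` fixes the embedded ring class field `K[f]`, `ℓ ∤ f` -/

section RingClass

variable (K : Type) [Field K] [NumberField K]

/-- **`G_𝔓` fixes `K[f] ⊆ K̄` pointwise for `ℓ ∤ f`**, `𝔓` any prime of `\bar ℤ_K` above the place `λ = (ℓ)` of an
inert rational prime `ℓ` prime to the conductor `f ≠ 0` (any `K`-embedding `e : K[f] → K̄`): `λ = ℓ𝓞_K` is principal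
and generated by an integer prime to `f`, so splits completely in the ring class field `K[f]`
(`mem_splitPrimes_ringClassField_of_span_natCast`); a Frobenius `F` at `𝔓` fixes `e(K[f])`
(`smul_algHom_eq_self_of_mem_splitPrimes`), so does `i·F` for `i` inertial, and `G_𝔓 = ⟨F⟩ · I_𝔓 · U` for the open
subgroup `U` fixing `e(K[f])`. bsd-jet's `JET.smul_ringClassFieldOne_eq_self_of_mem_decompositionSubgroup` is the case
`f = 1`; same proof. [cite: GrossLMS1991, §3 (proof of Prop. 3.7 (2): «λ is split completely in K_m/K, as it is principal and generated by an integer ℓ prime to m»)]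
[cite: McCallumLMS1991, §4 (p. 301: «there is an embedding K_m ↪ K_λ»)] [cite: Cox2013, Thm. 9.18] -/
theorem smul_ringClassField_eq_self_of_mem_decompositionSubgroup (hK : IsImaginaryQuadratic K)
    (ι : K →+* ℂ) {f : ℕ} (hf : f ≠ 0) {ℓ : ℕ} (hℓp : ℓ.Prime) (hℓP : (Ideal.span {(ℓ : 𝓞 K)}).IsPrime)
    (hℓf : Nat.Coprime ℓ f)
    (w : HeightOneSpectrum (𝓞 K)) (hw : (ℓ : 𝓞 K) ∈ w.asIdeal) {𝔓 : Ideal (absIntegers (𝓞 K) K)}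
    (h𝔓 : 𝔓 ∈ w.primesAbove) (e : ringClassField K ι f →ₐ[K] AlgebraicClosure K) {d : absoluteGaloisGroup K}
    (hd : d ∈ 𝔓.decompositionSubgroup (absoluteGaloisGroup K)) (y : ringClassField K ι f) :
    d • e y = e y := by
  haveI := (finiteDimensional_and_isGalois_ringClassField hK ι hf).1
  haveI := (finiteDimensional_and_isGalois_ringClassField hK ι hf).2
  haveI : NumberField (ringClassField K ι f) := NumberField.of_module_finite K _
  -- `w = (ℓ)` splits completely in `K[f]`
  have hwℓ : w.asIdeal = Ideal.span {((ℓ : ℕ) : 𝓞 K)} := by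
    have hne : Ideal.span {(ℓ : 𝓞 K)} ≠ ⊥ := by
      rw [Ne, Ideal.span_singleton_eq_bot]; exact_mod_cast hℓp.ne_zero
    exact ((hℓP.isMaximal hne).eq_of_le w.isPrime.ne_top ((Ideal.span_singleton_le_iff_mem _).mpr hw)).symm
  have hsplit : w ∈ splitPrimes K (ringClassField K ι f) :=
    mem_splitPrimes_ringClassField_of_span_natCast hK ι hf hwℓ hℓf
  -- Frobenius elements at `𝔓` fix `e(K[f])`; so do inertia elements (`i = (iF)F⁻¹`)
  obtain ⟨F, hF⟩ := HeightOneSpectrum.exists_isArithFrobAt_of_mem_primesAbove_holds h𝔓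
  have hFrob : ∀ {Φ : absoluteGaloisGroup K}, IsArithFrobAt (𝓞 K) Φ 𝔓 → ∀ z, Φ • e z = e z :=
    fun hΦ z ↦ smul_algHom_eq_self_of_mem_splitPrimes e hsplit h𝔓 hΦ z
  have hIner : ∀ i ∈ 𝔓.inertia (absoluteGaloisGroup K), ∀ z, i • e z = e z := by
    intro i hi z
    have h1 : (i * F) • e z = e z := hFrob ((isArithFrobAt_mul_iff_of_mem_inertia hi).mpr hF) z
    rw [mul_smul, hFrob hF z] at h1
    exact h1
  have hpow : ∀ (n : ℕ) z, (F ^ n) • e z = e z := by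
    intro n z
    induction n with
    | zero => rw [pow_zero, one_smul]
    | succ n ih => rw [pow_succ, mul_smul, hFrob hF z, ih]
  -- the open subgroup fixing `e(K[f])`
  haveI : FiniteDimensional K e.fieldRange :=
    LinearEquiv.finiteDimensional (AlgEquiv.ofInjectiveField e).toLinearEquiv
  let U : Subgroup (absoluteGaloisGroup K) := e.fieldRange.fixingSubgroup
  have hU : IsOpen (U : Set (absoluteGaloisGroup K)) := IntermediateField.fixingSubgroup_isOpen e.fieldRange
  obtain ⟨n, i, u, hi, hu, rfl⟩ := exists_eq_frobenius_pow_mul_of_mem_decompositionSubgroup h𝔓 hF hU hd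
  have huz : u • e y = e y := by
    have hy : e y ∈ e.fieldRange := ⟨y, rfl⟩
    exact (mem_fixingSubgroup_iff_forall_smul e.fieldRange u).mp hu ⟨e y, hy⟩
  rw [mul_smul, mul_smul, huz, hIner i hi, hpow]

end RingClass

/-! ### §2 … hence fixes `E(K[m]) ⊆ E(K̄)` and the derived point `P_m` -/

section Datum

-- `K : Type`: the tree's ring-class class field theory is universe `0`.
variable {K : Type} [Field K] [NumberField K] {N : ℕ} [NeZero N] {W : WeierstrassCurve ℚ}
  {Dt : ModularParametrizationData W N} {β : ℤ} {ι : K →+* ℂ} {m : ℕ}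
  (d : KolyvaginHeegnerData Dt β ι m)

/-- An element of `Γ_K` fixing `d.emb (K[m]) ⊆ K̄` pointwise fixes every point of `E(K[m]) ⊆ E(K̄)` (coordinates);
koly's `KolyCert.smul_toGeomPoints_of_forall_emb`, restated here to keep this file off the route cone. Silverman *AEC*
VIII.§1. [folklore] -/
theorem smul_toGeomPoints_of_forall_emb' (g : absoluteGaloisGroup K)
    (hg : ∀ x : ringClassField K ι m,
      (show AlgebraicClosure K ≃ₐ[K] AlgebraicClosure K from g) (d.emb x) = d.emb x)
    (P : (W.baseChange (ringClassField K ι m)).toAffine.Point) :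
    g • d.toGeomPoints P = d.toGeomPoints P := by
  rcases P with _ | ⟨x, y, hxy⟩
  · rfl
  · have hns1 : ((W.baseChange K).baseChange (AlgebraicClosure K)).toAffine.Nonsingular
        (d.emb x) (d.emb y) :=
      (Affine.baseChange_nonsingular W d.emb.toRatAlgHom.injective x y).mpr hxy
    change Affine.Point.map (W' := W.baseChange K)
        ((show AlgebraicClosure K ≃ₐ[K] AlgebraicClosure K from g) :
          AlgebraicClosure K →ₐ[K] AlgebraicClosure K)
        (Affine.Point.some (d.emb x) (d.emb y) hns1) =
      Affine.Point.some (d.emb x) (d.emb y) hns1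
    rw [Affine.Point.map_some]
    simp only [Affine.Point.some.injEq, AlgEquiv.coe_toAlgHom]
    exact ⟨hg x, hg y⟩

/-- **`G_𝔓` (any `𝔓 ∣ λ = (ℓ)`, `ℓ ∤ m` inert) fixes `E(K[m]) ⊆ E(K̄)`**: every point of `E(K[m])`, embedded by the
datum, has coordinates in `d.emb(K[m])`, which `G_𝔓` fixes pointwise (§1; `smul_toGeomPoints_of_forall_emb`). In
particular it fixes the derived Heegner point `P_m` («`P_m ∈ E(K_λ)`», McCallum p. 301). [cite: McCallumLMS1991, §4 (p. 301), Lemma 4.3]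
[cite: GrossLMS1991, §3 (proof of Prop. 3.7 (2))] -/
theorem smul_toGeomPoints_eq_of_mem_decompositionSubgroup (hK : IsImaginaryQuadratic K) (hm : m ≠ 0)
    {ℓ : ℕ} (hℓp : ℓ.Prime) (hℓP : (Ideal.span {(ℓ : 𝓞 K)}).IsPrime) (hℓm : Nat.Coprime ℓ m)
    (w : HeightOneSpectrum (𝓞 K)) (hw : (ℓ : 𝓞 K) ∈ w.asIdeal) {𝔓 : Ideal (absIntegers (𝓞 K) K)}
    (h𝔓 : 𝔓 ∈ w.primesAbove) {g : absoluteGaloisGroup K}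
    (hg : g ∈ 𝔓.decompositionSubgroup (absoluteGaloisGroup K))
    (P : (W.baseChange (ringClassField K ι m)).toAffine.Point) :
    g • d.toGeomPoints P = d.toGeomPoints P := by
  let e : ringClassField K ι m →ₐ[K] AlgebraicClosure K :=
    { d.emb with commutes' := fun k ↦ d.emb_apply k }
  have he : ∀ x, e x = d.emb x := fun _ ↦ rfl
  refine smul_toGeomPoints_of_forall_emb' d g (fun x ↦ ?_) P
  have h := smul_ringClassField_eq_self_of_mem_decompositionSubgroup K hK ι hm hℓp hℓP hℓm w hw h𝔓 e hg x
  rw [he] at h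
  exact h

/-- **`Γ_{K_λ}` fixes `E(K[m]) ⊆ E(K̄)`** (`λ = (ℓ)`, `ℓ ∤ m`), through `res : Γ_{K_λ} → Γ_K`, whose image is the
decomposition group of the prime `𝔓₀ ∣ λ` cut out by `K̄ → K̄_λ` (`decompositionSubgroup_adicCompletionPrime_eq_range`).
[cite: McCallumLMS1991, §4 (p. 301)] [cite: NeukirchANT1999, Ch. II §9 Prop. (9.6)] -/
theorem absGaloisRestrict_smul_toGeomPoints_eq (hK : IsImaginaryQuadratic K) (hm : m ≠ 0)
    {ℓ : ℕ} (hℓp : ℓ.Prime) (hℓP : (Ideal.span {(ℓ : 𝓞 K)}).IsPrime) (hℓm : Nat.Coprime ℓ m)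
    (w : HeightOneSpectrum (𝓞 K)) (hw : (ℓ : 𝓞 K) ∈ w.asIdeal)
    (g : absoluteGaloisGroup (w.adicCompletion K)) (P : (W.baseChange (ringClassField K ι m)).toAffine.Point) :
    absGaloisRestrict K (w.adicCompletion K) g • d.toGeomPoints P = d.toGeomPoints P := by
  have hmem : absGaloisRestrict K (w.adicCompletion K) g ∈
      (adicCompletionPrime K w).decompositionSubgroup (absoluteGaloisGroup K) := by
    rw [decompositionSubgroup_adicCompletionPrime_eq_range]
    exact ⟨g, rfl⟩
  exact smul_toGeomPoints_eq_of_mem_decompositionSubgroup d hK hm hℓp hℓP hℓm w hw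
    (adicCompletionPrime_mem_primesAbove K w) hmem P

end Datum

/-! ### §3 McCallum's class at a field whose Galois group fixes `P` and `E[n]`: the Kummer cocycle `g ↦ gQ − Q` -/

section Local

universe u

variable {K : Type u} [Field K] [NumberField K] (X : WeierstrassCurve K) [X.IsElliptic] {n : ℤ}
  (hdiv : ∀ P : geomPoints X, ∃ Q : geomPoints X, n • Q = P) {A : AddSubgroup (geomPoints X)}
  (E : Type u) [Field E] [Algebra K E]

/-- **`c(P)_E = 0 ⟺` McCallum's cocycle VANISHES on `Γ_E`**, for a `K`-field `E` whose absolute Galois group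
fixes `E[n]` (a Kolyvagin prime of index `≥` the exponent of `n`): the cocycle `g ↦ gQ − Q − (g−1)P/n` restricted along
`res : Γ_E → Γ_K` takes values in the TRIVIAL `Γ_E`-module `E[n]`, whose only coboundary is `0`
(`E(K̄)[n] ≅ E(K̄_E)[n]`). This is the currency of CORNER-G9 §3: «`loc_λ c ∈ torsionLocalKer` ⟺ the cocycle vanishes on
the decomposition group». The general case (used for `c_M(mℓ)` at `λ ∣ ℓ`, step (b)); the case of a fixed `P` is
`kolyvaginClass_mem_torsionLocalKer_iff_forall_smul_eq`. [cite: McCallumLMS1991, §3 (3), §4 (6), Lemma 4.1]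
[cite: GrossLMS1991, Prop. 9.6] -/
theorem kolyvaginClass_mem_torsionLocalKer_iff_forall_cocycle_eq_zero (hn : n ≠ 0)
    (hA : IsAdmissible (absoluteGaloisGroup K) A n)
    {P : geomPoints X} (hP : P ∈ invPoints (absoluteGaloisGroup K) A n) {Q : geomPoints X} (hQ : n • Q = P)
    (htriv : ∀ (h : absoluteGaloisGroup E) (T : geomTorsion X n), resGal (K := K) E h • T = T) :
    kolyvaginClass X n hdiv hA P hP ∈ X.torsionLocalKer E n ↔
      ∀ h : absoluteGaloisGroup E,
        resGal (K := K) E h • Q - Q - rootIn A n (resGal (K := K) E h • P - P) = 0 := by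
  rw [kolyvaginClass_eq_cls hA hP hQ]
  unfold cls
  change oneCocycleClass _ _ ∈ resKer _ _ _ ↔ _
  rw [oneCocycleClass_mem_resKer_iff]
  -- `Γ_E` fixes the local `n`-torsion
  have hfixloc : ∀ (h : absoluteGaloisGroup E) (a : AddSubgroup.torsionBy (localPoints X E) n), h • a = a :=
    fun h a ↦ by
      obtain ⟨T, rfl⟩ := (torsionPointsMap_bijective_of_ne_zero X _ (E := E) hn).2 a
      rw [← torsionPointsMap_smul, htriv]
  constructor
  · rintro ⟨a, ha⟩ h
    have h0 : torsionPointsMap X E n ((cocycle hA (continuous_smul_geomPoints X) hP hQ).1 (resGal (K := K) E h)) = 0 := by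
      rw [ha h, hfixloc, sub_self]
    have h1 : (cocycle hA (continuous_smul_geomPoints X) hP hQ).1 (resGal (K := K) E h) = 0 :=
      (torsionPointsMap_bijective_of_ne_zero X _ (E := E) hn).1 (by rw [h0, map_zero])
    have h2 := congrArg Subtype.val h1
    rw [coe_cocycle_apply] at h2
    exact h2
  · intro h
    refine ⟨0, fun g ↦ ?_⟩
    rw [smul_zero, sub_zero]
    have h1 : (cocycle hA (continuous_smul_geomPoints X) hP hQ).1 (resGal (K := K) E g) = 0 := by
      apply Subtype.ext
      rw [coe_cocycle_apply, h g]
      rfl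
    rw [h1, map_zero]

/-- **`c(P)_E = 0 ⟺ Γ_E fixes `P/n`** — McCallum's Lemma 4.3 («`c_M(n)_λ = δ(P_n)`») in kernel currency. For
McCallum's class `c(P) ∈ H¹(K, E[n])` of `P ∈ A` (admissible `A`, `[P]` invariant) and a `K`-field `E` whose absolute
Galois group (through `res : Γ_E → Γ_K`) FIXES `P` and FIXES `E[n]`: `c(P)` dies in `H¹(E, E[n])`
(`torsionLocalKer`) iff every `g ∈ Γ_E` fixes a chosen root `Q`, `nQ = P`. Indeed on `res Γ_E` the correction term
of McCallum's cocycle vanishes (`(g−1)P = 0`), leaving `g ↦ gQ − Q`, and a cocycle of the TRIVIAL module `E[n]` is a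
coboundary only if it is zero (`E(K̄)[n] ≅ E(K̄_E)[n]`, `torsionPointsMap_bijective_of_ne_zero`).
[cite: McCallumLMS1991, §4 Lemma 4.3 (p. 301), §3 (3)] [cite: GrossLMS1991, Prop. 6.2 (2) (proof), Prop. 9.6] -/
theorem kolyvaginClass_mem_torsionLocalKer_iff_forall_smul_eq (hn : n ≠ 0)
    (hA : IsAdmissible (absoluteGaloisGroup K) A n)
    {P : geomPoints X} (hP : P ∈ invPoints (absoluteGaloisGroup K) A n) {Q : geomPoints X} (hQ : n • Q = P)
    (hfix : ∀ h : absoluteGaloisGroup E, resGal (K := K) E h • P = P)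
    (htriv : ∀ (h : absoluteGaloisGroup E) (T : geomTorsion X n), resGal (K := K) E h • T = T) :
    kolyvaginClass X n hdiv hA P hP ∈ X.torsionLocalKer E n ↔
      ∀ h : absoluteGaloisGroup E, resGal (K := K) E h • Q = Q := by
  rw [kolyvaginClass_mem_torsionLocalKer_iff_forall_cocycle_eq_zero X hdiv E hn hA hP hQ htriv]
  refine forall_congr' fun h ↦ ?_
  rw [hfix, sub_self, rootIn_zero hA.eq_zero_of_zsmul, sub_zero, sub_eq_zero]

/-- **`k • c(P)` dies at `E` iff `Γ_E` fixes `kQ`** (`k • c(P) = c(kP)` with root `kQ`, `cls_zsmul`): so the ORDER of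
`c(P)_E` in `H¹(E, E[n])` is the order of the homomorphism `g ↦ gQ − Q` on `Γ_E` — for `n = p^M` the least `p^j` with
`Γ_E` fixing `p^j Q`. [cite: McCallumLMS1991, §4 Lemma 4.3, Prop. 4.4 («ord c_M(m)_λ»)] -/
theorem zsmul_kolyvaginClass_mem_torsionLocalKer_iff (hn : n ≠ 0)
    (hA : IsAdmissible (absoluteGaloisGroup K) A n)
    {P : geomPoints X} (hP : P ∈ invPoints (absoluteGaloisGroup K) A n) {Q : geomPoints X} (hQ : n • Q = P)
    (hfix : ∀ h : absoluteGaloisGroup E, resGal (K := K) E h • P = P)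
    (htriv : ∀ (h : absoluteGaloisGroup E) (T : geomTorsion X n), resGal (K := K) E h • T = T) (k : ℤ) :
    k • kolyvaginClass X n hdiv hA P hP ∈ X.torsionLocalKer E n ↔
      ∀ h : absoluteGaloisGroup E, resGal (K := K) E h • (k • Q) = k • Q := by
  have hkP : k • P ∈ invPoints (absoluteGaloisGroup K) A n := AddSubgroup.zsmul_mem _ hP k
  have hkQ : n • (k • Q) = k • P := by rw [smul_comm, hQ]
  have hfixk : ∀ h : absoluteGaloisGroup E, resGal (K := K) E h • (k • P) = k • P := fun h ↦ by
    rw [smul_zsmul_comm, hfix]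
  rw [kolyvaginClass_eq_cls hA hP hQ, ← cls_zsmul hA _ hP hQ k hkP hkQ, ← kolyvaginClass_eq_cls hA hkP hkQ]
  exact kolyvaginClass_mem_torsionLocalKer_iff_forall_smul_eq X hdiv E hn hA hkP hkQ hfixk htriv

end Local

/-! ### §4 Assembly: `c_M(m)` of a Kolyvagin–Heegner datum at the place of a Zhang–Kolyvagin prime `ℓ ∤ m` -/

section Assembly

variable {K : Type} [Field K] [NumberField K] {W : WeierstrassCurve ℚ} [W.IsElliptic] [W.IsGloballyMinimal]
  [NeZero (W.conductorNorm ℤ)]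
  {Dt : ModularParametrizationData W (W.conductorNorm ℤ)} {β : ℤ} {ι : K →+* ℂ} {m : ℕ}
  (d : KolyvaginHeegnerData Dt β ι m)

/-- **`ord c_M(m)_λ` is the order of the Kummer cocycle of `P_m` on `Γ_{K_λ}`** at the place `λ = (ℓ)` of a
Zhang–Kolyvagin prime `ℓ ∤ m` of index `≥ M` (`K` imaginary quadratic, `m ≠ 0`): on the admissible ∕ invariant branch
(`hA`, `hP` — Gross Lemma 4.3 ∕ Prop. 3.6, kernel under (irr) resp. for data at the divisors), for every `p^M`-th root
`Q` of `P_m ∈ E(K̄)` and every `k`,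
`k • c_M(m) ∈ ker(H¹(K, E[p^M]) → H¹(K_λ, E[p^M])) ⟺ Γ_{K_λ}` fixes `kQ`.
Inputs, all kernel and image-free: `Γ_{K_λ}` fixes `E[p^M]` (`absGaloisRestrict_smul_geomTorsion_eq_of_le_kolyvaginIndex`)
and fixes `P_m` (§2). This is the «`c_M(m)`» half of McCallum's Prop. 4.4 «ord c_M(mℓ)_λ = ord c_M(m)_λ» — step (a) of
CORNER-G9 §3. [cite: McCallumLMS1991, §4 Lemma 4.3, Prop. 4.4 (p. 301)] [cite: GrossLMS1991, Prop. 6.2 (2)] -/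
theorem zsmul_kolyvaginClass_conductor_mem_torsionLocalKer_iff (hK : IsImaginaryQuadratic K) (hm : m ≠ 0)
    {p : ℕ} [Fact p.Prime] {M : ℕ} {ℓ : ℕ} (hℓ : Zhang2014.IsKolyvaginPrime (W.conductorNorm ℤ) W K p ℓ)
    (hM : M ≤ Zhang2014.kolyvaginIndex W p ℓ) (hℓm : ¬ ℓ ∣ m)
    (w : HeightOneSpectrum (𝓞 K)) (hw : (ℓ : 𝓞 K) ∈ w.asIdeal)
    (hA : IsAdmissible (absoluteGaloisGroup K) d.pointsSubgroup ((p ^ M : ℕ) : ℤ))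
    (hP : d.toGeomPoints d.derivedPoint ∈ invPoints (absoluteGaloisGroup K) d.pointsSubgroup ((p ^ M : ℕ) : ℤ))
    {Q : geomPoints (W.baseChange K)} (hQ : ((p ^ M : ℕ) : ℤ) • Q = d.toGeomPoints d.derivedPoint) (k : ℤ) :
    k • d.kolyvaginClass (Fact.out : p.Prime) M ∈ (W.baseChange K).torsionLocalKer (w.adicCompletion K) ((p ^ M : ℕ) : ℤ) ↔
      ∀ g : absoluteGaloisGroup (w.adicCompletion K), absGaloisRestrict K (w.adicCompletion K) g • (k • Q) = k • Q := by
  have hp : p.Prime := Fact.out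
  haveI : (W.baseChange K).IsElliptic := inferInstanceAs (W.map (algebraMap ℚ K)).IsElliptic
  have hn : ((p ^ M : ℕ) : ℤ) ≠ 0 := by exact_mod_cast pow_ne_zero M hp.ne_zero
  -- the ℚ-place below `w` and good reduction there (`ℓ ∤ N`)
  have hℓv : (ℓ : 𝓞 ℚ) ∈ (w.under (𝓞 ℚ)).asIdeal := by
    change (ℓ : 𝓞 ℚ) ∈ w.asIdeal.under (𝓞 ℚ)
    rw [Ideal.under_def, Ideal.mem_comap, map_natCast]; exact hw
  have hgood : W.HasGoodReductionAt (w.under (𝓞 ℚ)) :=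
    Summit.BirchSwinnertonDyer.Rank1Residual.X11b.Three.Koly.Method2.LocalFrob.hasGoodReductionAt_rat_of_not_dvd_conductorNorm
      W hℓ.1 hℓ.2.1 _ hℓv
  have htriv : ∀ (g : absoluteGaloisGroup (w.adicCompletion K)) (T : geomTorsion (W.baseChange K) ((p ^ M : ℕ) : ℤ)),
      resGal (K := K) (w.adicCompletion K) g • T = T := fun g T ↦
    absGaloisRestrict_smul_geomTorsion_eq_of_le_kolyvaginIndex W hK hℓ hM hℓv hgood hw g T
  have hcop : Nat.Coprime ℓ m := (Nat.Prime.coprime_iff_not_dvd hℓ.1).mpr hℓm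
  have hfix : ∀ g : absoluteGaloisGroup (w.adicCompletion K),
      resGal (K := K) (w.adicCompletion K) g • d.toGeomPoints d.derivedPoint = d.toGeomPoints d.derivedPoint :=
    fun g ↦ absGaloisRestrict_smul_toGeomPoints_eq d hK hm hℓ.1 hℓ.2.2.2.2.1 hcop w hw g d.derivedPoint
  rw [d.kolyvaginClass_of_admissible hp M hA hP]
  exact zsmul_kolyvaginClass_mem_torsionLocalKer_iff (W.baseChange K) _ (w.adicCompletion K) hn hA hP hQ hfix
    htriv k

end Assembly

end Summit.BirchSwinnertonDyer.BirchSwinnertonDyer.Theorems.Prop44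

end
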